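import Summits.QuantumFields.YangMills.Theses.UnitScaleTilt
import Literature.MathematicalPhysics.QuantumFieldTheory.Balaban1983to89.T3SmallLiftHistory
import Literature.MathematicalPhysics.QuantumFieldTheory.Balaban1983to89.BlockAveragingExpMeanLogContinuous
import Literature.MathematicalPhysics.QuantumFieldTheory.Balaban1983to89.BlockAveragingPlaquetteBound

/-!
# Route `UnitScaleTilt` — crux K1bR-pr `FluctuationComparisonRegPr` (stmt-QuantumFields-19201), stub `stub_posOnSmall`:
# «LEMMA B» (FIBRE POSITIVITY) ⇐ MEASURE-OPENNESS OF THE ITERATED (0.4) AVERAGING — the measure theory of the restricted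
# Radon–Nikodym tower densities (support file `--supports stmt-QuantumFields-19201`; the stub stays open)

Fleet lead `ym-ust-19201-p1` (gen 0).  The registered stub `stub_posOnSmall` of the birth skeleton `04793f26c2da46ec` asks that, for
small coupling, BOTH runs' restricted height densities `heightDensity … (histGood K ⌊K/m⌋)`, `heightDensity … (histGood (K+1) ⌊K/m⌋)` are
positive Haar-a.e. on the `θ(⌊K/m⌋)`-small region of the comparison lattice.  The densities are Radon–Nikodym VERSIONS (tree
`AveragingRT.rnDensity`), so (p2 g5, `T3SmallLiftHistory`) this is not bookkeeping: `T3SmallLiftHistory.posOnSmall_of_smallLift` (p428548)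
reduces it to `OneStepSmallLift` (gain `κ√L ≤ 1`) ∧ `FibrePositivity` («Lemma B»: for a.e. datum whose descent fibre meets the event the
density is positive; NOT printed — «co-area for the submersion avg»).

THIS FILE is the measure theory of «Lemma B» (no property of the averaging map beyond measurability is used):

* §1 (tower level, run `K`, any measurable event `S`, `γ ≥ 0`): **`setIntegral_resDensity_eq`** `∫_A ρ^S_k dV = ∫_{S ∩ (avg^k)⁻¹A} e^{−β_K A} dU`
  — the measure `ρ^S_k dV_k` IS the push-forward of the restricted Gibbs weight ([Balaban1985UV3] (2)/(6) with the test function `1_A`);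
  hence the zero set of `ρ^S_k` is `(avg^k)_*(1_S e^{−βA}dU)`-null (`measure_inter_preimage_eq_zero_of_setIntegral_eq_zero`, the Boltzmann
  weight is positive), so `ρ^S_k > 0` a.e. on the image `avg^k(S)` as soon as `avg^k` is MEASURE-OPEN on `S`
  — `dU(S ∩ (avg^k)⁻¹A) = 0 ⇒ dV(A ∩ avg^k(S)) = 0` for measurable `A` (**`resDensity_pos_ae_image_of_measureOpen`**) — and `ρ^S_k > 0`
  a.e. on any `T` with `dV|_T ≪ (avg^k)_*(dU|_S)` (**`resDensity_pos_ae_on_of_absolutelyContinuous`**).  No Radon–Nikodym lemma is needed.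
* §2 (comparison lattice, through the measure-preserving level identification `fieldShift`): **`fibrePositivity_of_measureOpen`** —
  `T3SmallLiftHistory.FibrePositivity F γ h S` ⇐ measure-openness of `avg^{K−n}` on `S`; **`heightDensity_pos_ae_on_plaqSmall_of_absolutelyContinuous`**
  — positivity a.e. on `{PlaqSmall θ}` ⇐ reverse absolute continuity `dV_{K−n}|_{θ-small} ≪ (avg^{K−n})_*(dU|_S)`.

* §3 (one (0.4) step with the PRINTED `exp[mean log]` on `SU(N)`): it is CONTINUOUS on the small fields `{PlaqSmall a}`, `((d+2)L)²a/4 ≤ δ_N/2`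
  (**`continuousOn_blockAvg_expMeanLogSU`**: every loop variable is in the half-guard, `LatticeWordStokes.dist1_loopHol_le`, where the guarded
  average coincides with the tree's continuous extension `expMeanLogSUc`, `continuous_avgFun_expMeanLogSUc`); the small-field regions are open
  (`isOpen_setOf_plaqSmall`).

The sibling file `UnitScaleTiltFluctuationComparisonRegPrPosOnSmallReduction` derives measure-openness of the ITERATED averaging on the
UV-small histories from ONE-STEP properties (tower lemma) and assembles the registered signature of `stub_posOnSmall`.
Nothing of Bałaban's is asserted; every declaration is measure theory about the published formulas (2)/(6)/(7) of [Balaban1985UV3].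
-/

noncomputable section

open MeasureTheory Filter Topology
open Literature.MathematicalPhysics.QuantumFieldTheory.Balaban1983to89
open Literature.MathematicalPhysics.QuantumFieldTheory.Balaban1983to89.T3ContinuumYM3Torus
open Literature.MathematicalPhysics.QuantumFieldTheory.Balaban1983to89.T3LevelShift
open Literature.MathematicalPhysics.QuantumFieldTheory.Balaban1983to89.T3UnitLawDensityEML (ℰp measurableE_ℰp)
open Literature.MathematicalPhysics.QuantumFieldTheory.Balaban1983to89.T3UnitScaleTilt
open Literature.MathematicalPhysics.QuantumFieldTheory.Balaban1983to89.T3RestrictedUnitDensity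
open Literature.MathematicalPhysics.QuantumFieldTheory.Balaban1983to89.T3TiltDescent
open Literature.MathematicalPhysics.QuantumFieldTheory.Balaban1983to89.T3ConstrainedMinimiser
open Literature.MathematicalPhysics.QuantumFieldTheory.Balaban1983to89.T3SmallLiftHistory
open Literature.MathematicalPhysics.QuantumFieldTheory.Balaban1983to89.T3Thresholds
open Literature.MathematicalPhysics.QuantumFieldTheory.Balaban1983to89.Missing
open Literature.MathematicalPhysics.QuantumFieldTheory.Balaban1983to89.T4Continuum

namespace Summit.QuantumFields.YangMills.Theorems.FibrePositivity

/-! ## §1 Tower level: the restricted densities `ρ^S_k` are positive a.e. wherever the averaging is measure-open -/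

section Tower

variable (F : T3Family) (γ : ℝ) (K : ℕ) {S : Set (GaugeField (F.P K) 0 (Matrix.specialUnitaryGroup (Fin 2) ℂ))}

/-- The iterated (0.4) block averaging of the `K`-th approximation is measurable. [cite: Balaban1987RG1, (0.4)/(0.11) p.253] -/
theorem measurable_iterAvg (k : ℕ) :
    Measurable (Averaging.iter (fun i => BlockAveraging.blockAvg (P := F.P K) (j := i) ℰp) k) :=
  measurable_iter _ (F.avgMeasurable_of_measurableE ℰp measurableE_ℰp K) k

/-- **(2)/(6) ON AN EVENT**: `∫_A ρ^S_k dV_k = ∫_{S ∩ (avg^k)⁻¹A} e^{−β_K A(U)} dU` for measurable `A` (`k ≤ m + K`, `γ ≥ 0`):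
the measure `ρ^S_k dV_k` IS the push-forward of `1_S e^{−β_K A} dU` under the `k`-fold averaging. [cite: Balaban1985UV3, (2) p.256 and (6) p.257] -/
theorem setIntegral_resDensity_eq (hS : MeasurableSet S) (hγ : 0 ≤ γ) {k : ℕ} (hk : k ≤ F.m + K)
    {A : Set (GaugeField (F.P K) k (Matrix.specialUnitaryGroup (Fin 2) ℂ))} (hA : MeasurableSet A) :
    ∫ V in A, resDensity F γ K S k V ∂fieldMeasure (F.P K) k (Matrix.specialUnitaryGroup (Fin 2) ℂ) =
      ∫ U in S ∩ (Averaging.iter (fun i => BlockAveraging.blockAvg (P := F.P K) (j := i) ℰp) k) ⁻¹' A,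
        boltzmann (F.P K) ((F.scheme ℰp γ).β K) U ∂fieldMeasure (F.P K) 0 (Matrix.specialUnitaryGroup (Fin 2) ℂ) := by
  have hb : ∃ C : ℝ, ∀ V : GaugeField (F.P K) k (Matrix.specialUnitaryGroup (Fin 2) ℂ),
      |A.indicator (fun _ => (1 : ℝ)) V| ≤ C :=
    ⟨1, fun V => by by_cases hV : V ∈ A <;> simp [hV]⟩
  have key := integral_resDensity_mul F K hS hγ hk (A.indicator fun _ => (1 : ℝ)) (measurable_const.indicator hA) hb
  rw [← integral_indicator hA, ← integral_indicator (hS.inter (measurable_iterAvg F K k hA))]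
  have h1 : (fun V => A.indicator (resDensity F γ K S k) V) =
      fun V => resDensity F γ K S k V * A.indicator (fun _ => (1 : ℝ)) V := by
    funext V
    by_cases hV : V ∈ A <;> simp [hV]
  have h2 : (fun U => (S ∩ (Averaging.iter (fun i => BlockAveraging.blockAvg (P := F.P K) (j := i) ℰp) k) ⁻¹' A).indicator
        (boltzmann (F.P K) ((F.scheme ℰp γ).β K)) U) =
      fun U => S.indicator (boltzmann (F.P K) ((F.scheme ℰp γ).β K)) U *
        A.indicator (fun _ => (1 : ℝ)) (Averaging.iter (fun i => BlockAveraging.blockAvg (P := F.P K) (j := i) ℰp) k U) := by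
    funext U
    by_cases hU : U ∈ S
    · by_cases hU' : Averaging.iter (fun i => BlockAveraging.blockAvg (P := F.P K) (j := i) ℰp) k U ∈ A
      · have : U ∈ S ∩ (Averaging.iter (fun i => BlockAveraging.blockAvg (P := F.P K) (j := i) ℰp) k) ⁻¹' A := ⟨hU, hU'⟩
        simp [Set.indicator_of_mem this, Set.indicator_of_mem hU, Set.indicator_of_mem hU']
      · have : U ∉ S ∩ (Averaging.iter (fun i => BlockAveraging.blockAvg (P := F.P K) (j := i) ℰp) k) ⁻¹' A :=
          fun h => hU' h.2
        simp [Set.indicator_of_notMem this, Set.indicator_of_notMem hU']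
    · have : U ∉ S ∩ (Averaging.iter (fun i => BlockAveraging.blockAvg (P := F.P K) (j := i) ℰp) k) ⁻¹' A :=
        fun h => hU h.1
      simp [Set.indicator_of_notMem this, Set.indicator_of_notMem hU]
  rw [h1, h2]
  exact key

/-- **THE RESTRICTED GIBBS WEIGHT SEES EVERY NON-NULL PART OF `S`**: if `ρ^S_k` integrates to zero over a measurable `A`, then
`S ∩ (avg^k)⁻¹A` is Haar-null (the Boltzmann weight is strictly positive). [cite: Balaban1985UV3, (1)-(2) p.256] -/
theorem measure_inter_preimage_eq_zero_of_setIntegral_eq_zero (hS : MeasurableSet S) (hγ : 0 ≤ γ) {k : ℕ} (hk : k ≤ F.m + K)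
    {A : Set (GaugeField (F.P K) k (Matrix.specialUnitaryGroup (Fin 2) ℂ))} (hA : MeasurableSet A)
    (h0 : ∫ V in A, resDensity F γ K S k V ∂fieldMeasure (F.P K) k (Matrix.specialUnitaryGroup (Fin 2) ℂ) = 0) :
    fieldMeasure (F.P K) 0 (Matrix.specialUnitaryGroup (Fin 2) ℂ)
      (S ∩ (Averaging.iter (fun i => BlockAveraging.blockAvg (P := F.P K) (j := i) ℰp) k) ⁻¹' A) = 0 := by
  rw [setIntegral_resDensity_eq F γ K hS hγ hk hA] at h0
  set E := S ∩ (Averaging.iter (fun i => BlockAveraging.blockAvg (P := F.P K) (j := i) ℰp) k) ⁻¹' A with hE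
  have hEm : MeasurableSet E := hS.inter (measurable_iterAvg F K k hA)
  by_contra hne
  have hpos : 0 < fieldMeasure (F.P K) 0 (Matrix.specialUnitaryGroup (Fin 2) ℂ) E := pos_iff_ne_zero.mpr hne
  have hint : IntegrableOn (boltzmann (F.P K) ((F.scheme ℰp γ).β K)) E
      (fieldMeasure (F.P K) 0 (Matrix.specialUnitaryGroup (Fin 2) ℂ)) :=
    (integrable_boltzmann RegularGaugeGroup.measurable_reTr _ (F.scheme_β_nonneg ℰp hγ K)).integrableOn
  have hlt : 0 < ∫ U in E, boltzmann (F.P K) ((F.scheme ℰp γ).β K) U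
      ∂fieldMeasure (F.P K) 0 (Matrix.specialUnitaryGroup (Fin 2) ℂ) := by
    rw [setIntegral_pos_iff_support_of_nonneg_ae (Eventually.of_forall fun U => (boltzmann_pos _ _ U).le) hint]
    have hsupp : Function.support (boltzmann (G := Matrix.specialUnitaryGroup (Fin 2) ℂ) (F.P K) ((F.scheme ℰp γ).β K)) =
        Set.univ := by
      ext U
      simp only [Function.mem_support, Set.mem_univ, iff_true]
      exact (boltzmann_pos _ _ U).ne'
    rw [hsupp, Set.univ_inter]
    exact hpos
  exact hlt.ne' h0

/-- **`ρ^S_k > 0` ALMOST EVERYWHERE ON THE IMAGE `avg^k(S)` WHENEVER THE `k`-FOLD AVERAGING IS MEASURE-OPEN ON `S`**: if every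
subset `A` of `T^{(k)}` with `S ∩ (avg^k)⁻¹A` Haar-null meets `avg^k(S)` in a Haar-null set, then `ρ^S_k(V) > 0` for a.e. `V ∈ avg^k(S)`
(the densities are Radon–Nikodym versions: this is the located content of «Lemma B»). [cite: Balaban1985UV3, (2) p.256 and (41) p.266] -/
theorem resDensity_pos_ae_image_of_measureOpen (hS : MeasurableSet S) (hγ : 0 ≤ γ) {k : ℕ} (hk : k ≤ F.m + K)
    (hMO : ∀ A : Set (GaugeField (F.P K) k (Matrix.specialUnitaryGroup (Fin 2) ℂ)), MeasurableSet A →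
      fieldMeasure (F.P K) 0 (Matrix.specialUnitaryGroup (Fin 2) ℂ)
          (S ∩ (Averaging.iter (fun i => BlockAveraging.blockAvg (P := F.P K) (j := i) ℰp) k) ⁻¹' A) = 0 →
        fieldMeasure (F.P K) k (Matrix.specialUnitaryGroup (Fin 2) ℂ)
          (A ∩ (Averaging.iter (fun i => BlockAveraging.blockAvg (P := F.P K) (j := i) ℰp) k) '' S) = 0) :
    ∀ᵐ V ∂fieldMeasure (F.P K) k (Matrix.specialUnitaryGroup (Fin 2) ℂ),
      V ∈ (Averaging.iter (fun i => BlockAveraging.blockAvg (P := F.P K) (j := i) ℰp) k) '' S → 0 < resDensity F γ K S k V := by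
  set A := {V : GaugeField (F.P K) k (Matrix.specialUnitaryGroup (Fin 2) ℂ) | resDensity F γ K S k V = 0} with hA
  have hAm : MeasurableSet A := measurable_resDensity F γ K hS k (measurableSet_singleton 0)
  have h0 : ∫ V in A, resDensity F γ K S k V ∂fieldMeasure (F.P K) k (Matrix.specialUnitaryGroup (Fin 2) ℂ) = 0 :=
    setIntegral_eq_zero_of_forall_eq_zero fun V hV => hV
  have hnull := hMO A hAm (measure_inter_preimage_eq_zero_of_setIntegral_eq_zero F γ K hS hγ hk hAm h0)
  filter_upwards [measure_eq_zero_iff_ae_notMem.mp hnull] with V hV hVim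
  have hVA : V ∉ A := fun h => hV ⟨h, hVim⟩
  exact lt_of_le_of_ne (resDensity_nonneg F γ K S k V) (fun h => hVA h.symm)

/-- **`ρ^S_k > 0` ALMOST EVERYWHERE ON `T` UNDER REVERSE ABSOLUTE CONTINUITY**: if `dV_k|_T ≪ (avg^k)_*(dU|_S)` then `ρ^S_k > 0`
a.e. on `T` (any set `T`). [cite: Balaban1985UV3, (2) p.256 and (41) p.266] -/
theorem resDensity_pos_ae_on_of_absolutelyContinuous (hS : MeasurableSet S) (hγ : 0 ≤ γ) {k : ℕ} (hk : k ≤ F.m + K)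
    {T : Set (GaugeField (F.P K) k (Matrix.specialUnitaryGroup (Fin 2) ℂ))}
    (hAC : (fieldMeasure (F.P K) k (Matrix.specialUnitaryGroup (Fin 2) ℂ)).restrict T ≪
      Measure.map (Averaging.iter (fun i => BlockAveraging.blockAvg (P := F.P K) (j := i) ℰp) k)
        ((fieldMeasure (F.P K) 0 (Matrix.specialUnitaryGroup (Fin 2) ℂ)).restrict S)) :
    ∀ᵐ V ∂fieldMeasure (F.P K) k (Matrix.specialUnitaryGroup (Fin 2) ℂ), V ∈ T → 0 < resDensity F γ K S k V := by
  set A := {V : GaugeField (F.P K) k (Matrix.specialUnitaryGroup (Fin 2) ℂ) | resDensity F γ K S k V = 0} with hA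
  have hAm : MeasurableSet A := measurable_resDensity F γ K hS k (measurableSet_singleton 0)
  have h0 : ∫ V in A, resDensity F γ K S k V ∂fieldMeasure (F.P K) k (Matrix.specialUnitaryGroup (Fin 2) ℂ) = 0 :=
    setIntegral_eq_zero_of_forall_eq_zero fun V hV => hV
  have hpre := measure_inter_preimage_eq_zero_of_setIntegral_eq_zero F γ K hS hγ hk hAm h0
  have hmapA : Measure.map (Averaging.iter (fun i => BlockAveraging.blockAvg (P := F.P K) (j := i) ℰp) k)
      ((fieldMeasure (F.P K) 0 (Matrix.specialUnitaryGroup (Fin 2) ℂ)).restrict S) A = 0 := by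
    rw [Measure.map_apply (measurable_iterAvg F K k) hAm, Measure.restrict_apply (measurable_iterAvg F K k hAm),
      Set.inter_comm]
    exact hpre
  have hTA : fieldMeasure (F.P K) k (Matrix.specialUnitaryGroup (Fin 2) ℂ) (A ∩ T) = 0 := by
    rw [← Measure.restrict_apply hAm]
    exact hAC hmapA
  filter_upwards [measure_eq_zero_iff_ae_notMem.mp hTA] with V hV hVT
  have hVA : V ∉ A := fun h => hV ⟨h, hVT⟩
  exact lt_of_le_of_ne (resDensity_nonneg F γ K S k V) (fun h => hVA h.symm)

end Tower

/-! ## §2 The same read on the comparison lattice: `heightDensity`, «Lemma B» (`FibrePositivity`) from measure-openness -/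

section Height

variable (F : T3Family) (γ : ℝ) {n K : ℕ} (hK : n ≤ K) {S : Set (GaugeField (F.P K) 0 (Matrix.specialUnitaryGroup (Fin 2) ℂ))}

/-- **«LEMMA B» ⇐ MEASURE-OPENNESS OF THE `(K−n)`-FOLD AVERAGING ON `S`**: if every measurable `A ⊆ T^{(K−n)}_K` with
`S ∩ (avg^{K−n})⁻¹A` Haar-null meets `avg^{K−n}(S)` in a Haar-null set, then `FibrePositivity F γ h S` — for a.e. datum `V` of the
`n`-th approximation whose descent fibre in run `K` meets `S`, the restricted height density `ρ^S_{K−n}` read at `V` is positive.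
[cite: Balaban1985UV3, (2) p.256 and (41) p.266] -/
theorem fibrePositivity_of_measureOpen (hS : MeasurableSet S) (hγ : 0 ≤ γ)
    (hMO : ∀ A : Set (GaugeField (F.P K) (K - n) (Matrix.specialUnitaryGroup (Fin 2) ℂ)), MeasurableSet A →
      fieldMeasure (F.P K) 0 (Matrix.specialUnitaryGroup (Fin 2) ℂ)
          (S ∩ (Averaging.iter (fun i => BlockAveraging.blockAvg (P := F.P K) (j := i) ℰp) (K - n)) ⁻¹' A) = 0 →
        fieldMeasure (F.P K) (K - n) (Matrix.specialUnitaryGroup (Fin 2) ℂ)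
          (A ∩ (Averaging.iter (fun i => BlockAveraging.blockAvg (P := F.P K) (j := i) ℰp) (K - n)) '' S) = 0) :
    FibrePositivity F γ hK S := by
  have hae := resDensity_pos_ae_image_of_measureOpen F γ K hS hγ (k := K - n) (by omega) hMO
  have hmp := measurePreserving_fieldShift (G := Matrix.specialUnitaryGroup (Fin 2) ℂ)
    (F.sitesPerDir_eq (m := F.m) (K := K) (j := K - n) (m' := F.m) (K' := n) (j' := 0) (by omega))
  filter_upwards [hmp.quasiMeasurePreserving.ae hae] with V hV hfib
  obtain ⟨U, hU, hUS⟩ := hfib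
  have hUV : descendTo F ℰp n K hK U = V := hU
  refine hV ⟨U, hUS, ?_⟩
  rw [← hUV]
  show _ = fieldShift _ (fieldShift _ (Averaging.iter (fun i => BlockAveraging.blockAvg (P := F.P K) (j := i) ℰp) (K - n) U))
  rw [fieldShift_fieldShift, fieldShift_refl]

/-- **POSITIVITY ON A PRESCRIBED REGION ⇐ REVERSE ABSOLUTE CONTINUITY**: if `dV_{K−n}|_T ≪ (avg^{K−n})_*(dU|_S)` on the `K`-th
tower, then the restricted height density is positive at a.e. datum `V` whose height-`(K−n)` reading lies in `T`.
[cite: Balaban1985UV3, (2) p.256 and (41) p.266] -/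
theorem heightDensity_pos_ae_of_absolutelyContinuous (hS : MeasurableSet S) (hγ : 0 ≤ γ)
    {T : Set (GaugeField (F.P K) (K - n) (Matrix.specialUnitaryGroup (Fin 2) ℂ))}
    (hAC : (fieldMeasure (F.P K) (K - n) (Matrix.specialUnitaryGroup (Fin 2) ℂ)).restrict T ≪
      Measure.map (Averaging.iter (fun i => BlockAveraging.blockAvg (P := F.P K) (j := i) ℰp) (K - n))
        ((fieldMeasure (F.P K) 0 (Matrix.specialUnitaryGroup (Fin 2) ℂ)).restrict S)) :
    ∀ᵐ V ∂fieldMeasure (F.P n) 0 (Matrix.specialUnitaryGroup (Fin 2) ℂ),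
      fieldShift (F.sitesPerDir_eq (m := F.m) (K := K) (j := K - n) (m' := F.m) (K' := n) (j' := 0) (by omega)) V ∈ T →
        0 < heightDensity F γ hK S V := by
  have hae := resDensity_pos_ae_on_of_absolutelyContinuous F γ K hS hγ (k := K - n) (by omega) hAC
  have hmp := measurePreserving_fieldShift (G := Matrix.specialUnitaryGroup (Fin 2) ℂ)
    (F.sitesPerDir_eq (m := F.m) (K := K) (j := K - n) (m' := F.m) (K' := n) (j' := 0) (by omega))
  filter_upwards [hmp.quasiMeasurePreserving.ae hae] with V hV hVT
  exact hV hVT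

/-- **POSITIVITY ON THE SMALL-FIELD REGION OF THE COMPARISON LATTICE**: reverse absolute continuity towards the `θ`-small fields of
height `K − n` gives `ρ^S_{K−n} > 0` a.e. on `{V : PlaqSmall θ V}` (plaquettes correspond under the level identification).
[cite: Balaban1985UV3, (7) p.257 and (41) p.266] -/
theorem heightDensity_pos_ae_on_plaqSmall_of_absolutelyContinuous (hS : MeasurableSet S) (hγ : 0 ≤ γ) (θ : ℝ)
    (hAC : (fieldMeasure (F.P K) (K - n) (Matrix.specialUnitaryGroup (Fin 2) ℂ)).restrict {W | PlaqSmall θ W} ≪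
      Measure.map (Averaging.iter (fun i => BlockAveraging.blockAvg (P := F.P K) (j := i) ℰp) (K - n))
        ((fieldMeasure (F.P K) 0 (Matrix.specialUnitaryGroup (Fin 2) ℂ)).restrict S)) :
    ∀ᵐ V ∂fieldMeasure (F.P n) 0 (Matrix.specialUnitaryGroup (Fin 2) ℂ), PlaqSmall θ V → 0 < heightDensity F γ hK S V := by
  filter_upwards [heightDensity_pos_ae_of_absolutelyContinuous F γ hK hS hγ hAC] with V hV hVs
  exact hV ((T3CruxEstimates.plaqSmall_fieldShift F _ θ V).mpr hVs)

end Height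

/-! ## §3 One step of (0.4) with the printed `exp[mean log]` on `SU(N)` is CONTINUOUS on small fields -/

section OneStepContinuity

open BlockAveraging ExpMeanLog

variable {n : Type*} [Fintype n] [DecidableEq n] [Nonempty n] {P : Params} {j : ℕ}

/-- On a small field (`PlaqSmall a`, `(((d+2)L)²/4)·a ≤ δ_N/2`) the guarded (0.4) averaging with the printed (discontinuously
extended) `exp[mean log]` COINCIDES with the one driven by the tree's continuous extension `expMeanLogSUc`: every loop variable lies in
the half-guard (`LatticeWordStokes.dist1_loopHol_le`), where the two small-loop averages agree. [cite: Balaban1987RG1, (0.4) p.253] -/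
theorem avgFun_expMeanLogSU_eq_of_plaqSmall {a : ℝ} (ha : 0 ≤ a)
    (ht : ((((P.d + 2) * P.L : ℕ) : ℝ) ^ 2 / 4) * a ≤ deltaSU n / 2)
    {U : GaugeField P j (Matrix.specialUnitaryGroup n ℂ)} (hU : PlaqSmall a U) :
    avgFun (expMeanLogSU (n := n)) U = avgFun (expMeanLogSUc (n := n)) U := by
  funext c
  have hsm : ∀ i, dist1 (loopHol U c i) ≤ deltaSU n / 2 :=
    fun i => (LatticeWordStokes.dist1_loopHol_le ha hU c i).trans ht
  have hlt : ∀ i, dist1 (loopHol U c i) < deltaSU n :=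
    fun i => (hsm i).trans_lt (half_lt_self deltaSU_pos)
  have h1 : Small (expMeanLogSU (n := n)) U c := hlt
  have h2 : Small (expMeanLogSUc (n := n)) U c := hlt
  unfold avgFun corr
  rw [if_pos h1, if_pos h2]
  congr 1
  unfold LoopAverage.avg
  exact (expMeanLogSUc_E_eq _ fun i => hsm _).symm

/-- **THE (0.4) AVERAGING WITH THE PRINTED `exp[mean log]` IS CONTINUOUS ON THE SMALL FIELDS** `{PlaqSmall a}`,
`(((d+2)L)²/4)·a ≤ δ_N/2` (it agrees there with the continuous total extension, `continuous_avgFun_expMeanLogSUc`). [cite: Balaban1987RG1, (0.4) p.253] -/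
theorem continuousOn_blockAvg_expMeanLogSU {a : ℝ} (ha : 0 ≤ a)
    (ht : ((((P.d + 2) * P.L : ℕ) : ℝ) ^ 2 / 4) * a ≤ deltaSU n / 2) :
    ContinuousOn (blockAvg (P := P) (j := j) (expMeanLogSU (n := n))).avg
      {U : GaugeField P j (Matrix.specialUnitaryGroup n ℂ) | PlaqSmall a U} := by
  rw [blockAvg_avg]
  exact (continuous_avgFun_expMeanLogSUc (n := n)).continuousOn.congr
    fun U hU => avgFun_expMeanLogSU_eq_of_plaqSmall ha ht hU

/-- The small-field regions `{U : PlaqSmall δ U}` of `SU(N)`-valued configurations are OPEN (finitely many strict inequalities of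
continuous functions). [cite: Balaban1987RG1, (0.18) p.255] -/
theorem isOpen_setOf_plaqSmall (δ : ℝ) : IsOpen {U : GaugeField P j (Matrix.specialUnitaryGroup n ℂ) | PlaqSmall δ U} := by
  have hd : Continuous (dist1 : Matrix.specialUnitaryGroup n ℂ → ℝ) :=
    UnitaryModel.continuous_opDist1.comp (Literature.MathematicalPhysics.QuantumLattice.continuous_fundamentalRep n)
  have hb : ∀ b : PBond P j, Continuous fun U : GaugeField P j (Matrix.specialUnitaryGroup n ℂ) => U b :=
    fun b => continuous_apply b
  have hp : ∀ p : Plaq P j, Continuous fun U : GaugeField P j (Matrix.specialUnitaryGroup n ℂ) => GaugeField.plaqHol U p := by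
    intro p
    unfold GaugeField.plaqHol
    exact (((hb _).mul (hb _)).mul (hb _).inv).mul (hb _).inv
  have hset : {U : GaugeField P j (Matrix.specialUnitaryGroup n ℂ) | PlaqSmall δ U} =
      ⋂ p : Plaq P j, {U | dist1 (GaugeField.plaqHol U p) < δ} := by
    ext U
    simp only [PlaqSmall, Set.mem_setOf_eq, Set.mem_iInter]
  rw [hset]
  exact isOpen_iInter_of_finite fun p => isOpen_lt (hd.comp (hp p)) continuous_const

end OneStepContinuity

end Summit.QuantumFields.YangMills.Theorems.FibrePositivity

end
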